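import Literature.NumberTheory.Automorphic.RankinSelbergLocalUniqueness
import Literature.NumberTheory.Automorphic.RankinSelbergLocalGammaCounterexample
import HarnessLib

/-!
# The named fact `existsUnique_hasRSLFactor` of `RankinSelbergLocal`: false as elaborated,
# true for `m = 0` with its intended measure hypotheses

`Literature/NumberTheory/Automorphic/RankinSelbergLocal.lean` records Jacquet–Piatetski-Shapiro–
Shalika's existence and uniqueness of the local `L`-factor `L(s, π × π') = P(q^{-s})⁻¹`
(1983, Thm. 2.7 (i)–(ii); Cogdell, *Analytic theory of `L`-functions for `GL_n`*, Thm. 3.1) as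
the named fact `existsUnique_hasRSLFactor hmn π π' ψ ν : Prop` (`∃! P, HasRSLFactor hmn π π' ψ ν P`).
Its docstring asks `ν` to be an invariant measure on `GL_m(F) ⧸ U_m`, and the file declares
`[BorelSpace (GL_m ⧸ U_m)]`, `[SMulInvariantMeasure GL_m (GL_m ⧸ U_m) ν]`,
`[IsFiniteMeasureOnCompacts ν]`, `[ν.IsOpenPosMeasure]` as section instances — but a
`def … : Prop` abstracts only the section variables its body mentions, so none of them is an
argument of the fact (`@existsUnique_hasRSLFactor` ends
`… [MeasurableSpace (GL (Fin m) F ⧸ _)] (ν : Measure (GL (Fin m) F ⧸ _)) : Prop`; recorded in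
`RankinSelbergLocalUniqueness`, and for the sibling fact `existsUnique_hasRSGamma` in
`RankinSelbergLocalGammaCounterexample`). As elaborated the fact quantifies over ARBITRARY `ν`
and is false:

* `not_existsUnique_hasRSLFactor_zero_measure_of_hyp`: at `ν = 0` every zeta integral
  `∫ … ∂0` vanishes, so no `P` satisfies clause (b) of `HasRSLFactor`
  (`not_hasRSLFactor_zero_measure` of `RankinSelbergLocalUniqueness`) and the fact fails for all
  data meeting its hypotheses on `π, π', ψ`.
* `not_forall_existsUnique_hasRSLFactor`: a CLOSED counterexample to the universally quantified
  fact, with the data of `not_forall_existsUnique_hasRSGamma`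
  (`RankinSelbergLocalGammaCounterexample`): `F = ℚ_v` for a finite place `v` of `ℚ` at which the
  local component `ψ_v` of Tate's character is non-trivial (`eventually_exists_adeleAddCharAt_ne_one`,
  `continuous_adeleAddCharAt` of `AdelicAdditiveCharacterDuality`; `ℚ_v` is a non-archimedean
  local field by `AdicCompletionLocalField`), `n = 1`, `m = 0`, `π`, `π'` the trivial
  representations of `GL_1(ℚ_v)`, `GL_0(ℚ_v)` on `ℂ` (irreducible, admissible, generic:
  `isIrreducible_trivial_complex`, `isAdmissible_trivial_complex`, `isGeneric_trivial_of_le_one`),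
  and `ν = 0`.

So `theorem existsUnique_hasRSLFactor_holds : existsUnique_hasRSLFactor …` (all arguments
universally closed) is REFUTED. The intended statement — and, by JPSS Thm. 2.7 (i)–(ii), the true
one — carries the four instance hypotheses on `ν` inside the `∀`; the proved algebra of
`RankinSelbergLocalUniqueness` (`HasRSLFactor.unique`) and of `RankinSelbergLocalLFactor`
(the fractional-ideal step `exists_isLGenerator`, `existsUnique_hasRSLFactor_of_analytic_inputs`)
holds for every `ν` and serves the corrected fact unchanged.

* *The degenerate case `m = 0` of the intended statement holds* (and `HasRSLFactor` is
  satisfiable): for `GL_n × GL_0` the quotient `GL_0 ⧸ U_0` is a point, every zeta integral is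
  the constant `ν(pt) · W(1) W'(1)` (`rsZeta_fin_zero`), and for a measure `ν` that is finite on
  compacts and positive on non-empty opens — exactly the hypotheses the `def` lost — `P = 1` is
  the `L`-polynomial of any `ψ`-generic `π` and `ψ⁻¹`-generic `π'` (`hasRSLFactor_one_fin_zero`,
  `existsUnique_hasRSLFactor_fin_zero`; `L(s, π × 1_{GL_0}) = 1`).

No definitions or named facts are introduced here (D-0026).

## References

* H. Jacquet, I. I. Piatetski-Shapiro, J. Shalika, *Rankin–Selberg convolutions*, Amer. J. Math.
  105 (1983), 367–464, Thm. 2.7 (i)–(ii) [JacquetPiatetskiShapiroShalika1983].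
* J. W. Cogdell, *Analytic theory of `L`-functions for `GL_n`*, in Bernstein–Gelbart (eds.),
  *An Introduction to the Langlands Program*, §3.1, Thm. 3.1 (read: the integrals are over
  `N_m(k) \ GL_m(k)` with its invariant measure) [CogdellAnalyticTheory2004].
-/

set_option autoImplicit false

open MeasureTheory NumberField IsDedekindDomain

noncomputable section

namespace Literature.NumberTheory.Automorphic

section ZeroMeasure

variable {F : Type*} [Field F] [ValuativeRel F] [TopologicalSpace F] [IsNonarchimedeanLocalField F]
  {n m : ℕ} {V : Type*} [AddCommGroup V] [Module ℂ V] {V' : Type*} [AddCommGroup V'] [Module ℂ V']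
  [MeasurableSpace (GL (Fin m) F ⧸ upperUnitriangular (Fin m) F)]
  {hmn : m < n} {π : Representation ℂ (GL (Fin n) F) V} {π' : Representation ℂ (GL (Fin m) F) V'}
  {ψ : AddChar F Circle}

/-- **The named fact `existsUnique_hasRSLFactor` fails at `ν = 0`** for all data meeting its
hypotheses (`π`, `π'` irreducible admissible generic, `ψ` non-trivial continuous): it would
produce an `L`-polynomial `P` with `HasRSLFactor hmn π π' ψ 0 P`, which
`not_hasRSLFactor_zero_measure` excludes (all zeta integrals against `ν = 0` vanish, so `1/P` is
no combination of them). The measure `ν = 0` is admitted by the fact because its invariance /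
positivity hypotheses were section instances not captured by the `def`. [folklore] -/
theorem not_existsUnique_hasRSLFactor_zero_measure_of_hyp [π.IsIrreducible] [π'.IsIrreducible]
    (hπ : π.IsAdmissible) (hπ' : π'.IsAdmissible) (hg : IsGeneric π ψ) (hg' : IsGeneric π' ψ⁻¹)
    (hψ : ψ.IsContinuousNontrivial) :
    ¬ existsUnique_hasRSLFactor hmn π π' ψ
        (0 : Measure (GL (Fin m) F ⧸ upperUnitriangular (Fin m) F)) := fun h => by
  obtain ⟨P, hP, -⟩ := h hπ hπ' hg hg' hψ
  exact not_hasRSLFactor_zero_measure hP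

end ZeroMeasure

section Counterexample

/-- **The named fact `existsUnique_hasRSLFactor` of `RankinSelbergLocal`, universally closed, is
FALSE.** Counterexample: `F = ℚ_v` for a finite place `v` of `ℚ` at which the local component
`ψ_v` of Tate's character is non-trivial (all but finitely many `v`,
`eventually_exists_adeleAddCharAt_ne_one`; continuity: `continuous_adeleAddCharAt`), `n = 1`,
`m = 0`, `π`, `π'` the trivial representations of `GL_1(ℚ_v)`, `GL_0(ℚ_v)` on `ℂ` (irreducible,
admissible, generic since `U_1 = U_0 = 1`), and the ZERO measure `ν = 0` on `GL_0 ⧸ U_0`, which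
the fact admits because its invariance / Radon hypotheses were section instances not captured by
the `def`; then no `P` satisfies `HasRSLFactor` (`not_existsUnique_hasRSLFactor_zero_measure_of_hyp`).
The intended statement is Jacquet–Piatetski-Shapiro–Shalika 1983, Thm. 2.7 (i)–(ii) with `ν` THE
invariant measure (the four instances re-bound inside the `∀`). [folklore] -/
theorem not_forall_existsUnique_hasRSLFactor :
    ¬ ∀ (F : Type) [Field F] [ValuativeRel F] [TopologicalSpace F] [IsNonarchimedeanLocalField F]
        (n m : ℕ) (V : Type) [AddCommGroup V] [Module ℂ V] (V' : Type) [AddCommGroup V']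
        [Module ℂ V'] (hmn : m < n) (π : Representation ℂ (GL (Fin n) F) V)
        (π' : Representation ℂ (GL (Fin m) F) V') (ψ : AddChar F Circle)
        [MeasurableSpace (GL (Fin m) F ⧸ upperUnitriangular (Fin m) F)]
        (ν : Measure (GL (Fin m) F ⧸ upperUnitriangular (Fin m) F)),
        existsUnique_hasRSLFactor hmn π π' ψ ν := by
  intro h
  haveI := infinite_heightOneSpectrum' ℚ
  obtain ⟨v, u, -, hu⟩ := (eventually_exists_adeleAddCharAt_ne_one ℚ).exists
  letI : MeasurableSpace (GL (Fin 0) (v.adicCompletion ℚ) ⧸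
      upperUnitriangular (Fin 0) (v.adicCompletion ℚ)) := ⊤
  haveI := isIrreducible_trivial_complex (GL (Fin 1) (v.adicCompletion ℚ))
  haveI := isIrreducible_trivial_complex (GL (Fin 0) (v.adicCompletion ℚ))
  have hψ : (adeleAddCharAt ℚ v).IsContinuousNontrivial :=
    ⟨continuous_adeleAddCharAt ℚ v, fun h0 => hu (by rw [h0, AddChar.zero_apply])⟩
  exact not_existsUnique_hasRSLFactor_zero_measure_of_hyp
    (isAdmissible_trivial_complex _) (isAdmissible_trivial_complex _)
    (isGeneric_trivial_of_le_one le_rfl _) (isGeneric_trivial_of_le_one (Nat.zero_le 1) _) hψ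
    (h (v.adicCompletion ℚ) 1 0 ℂ ℂ Nat.zero_lt_one (Representation.trivial ℂ _ ℂ)
      (Representation.trivial ℂ _ ℂ) (adeleAddCharAt ℚ v) 0)

end Counterexample

/-! ### The degenerate case `m = 0`: the intended statement holds with `P = 1` -/

section FinZero

variable {F : Type*} [Field F] [ValuativeRel F] [TopologicalSpace F] [IsNonarchimedeanLocalField F]
  {n : ℕ} {V : Type*} [AddCommGroup V] [Module ℂ V] {V' : Type*} [AddCommGroup V'] [Module ℂ V']
  [MeasurableSpace (GL (Fin 0) F ⧸ upperUnitriangular (Fin 0) F)]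
  {hn : 0 < n} {π : Representation ℂ (GL (Fin n) F) V} {π' : Representation ℂ (GL (Fin 0) F) V'}
  {ψ : AddChar F Circle} {ν : Measure (GL (Fin 0) F ⧸ upperUnitriangular (Fin 0) F)}

omit [MeasurableSpace (GL (Fin 0) F ⧸ upperUnitriangular (Fin 0) F)] in
/-- For `m = 0` the Rankin–Selberg kernel on the one-point space `GL_0 ⧸ U_0` is the constant
`W(1) W'(1)` (`GL_0(F)` is the trivial group, `|det 1|^{s - n/2} = 1`). [folklore] -/
theorem rsKernel_fin_zero (W : GL (Fin n) F → ℂ) (W' : GL (Fin 0) F → ℂ) (s : ℂ)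
    (x : GL (Fin 0) F ⧸ upperUnitriangular (Fin 0) F) : rsKernel hn W W' s x = W 1 * W' 1 := by
  have hf : IsRightUInvariant (rsIntegrand hn W W' s) := fun g u =>
    congrArg (rsIntegrand hn W W' s) (Subsingleton.elim _ _)
  obtain ⟨g, rfl⟩ := QuotientGroup.mk_surjective x
  rw [rsKernel_mk hn hf g, Subsingleton.elim g 1]
  simp [rsIntegrand]

/-- For `m = 0` every zeta integral is the constant `ν(pt) · W(1) W'(1)`. [folklore] -/
theorem rsZeta_fin_zero (W : GL (Fin n) F → ℂ) (W' : GL (Fin 0) F → ℂ) (s : ℂ) :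
    rsZeta hn ν W W' s = (ν.real Set.univ : ℂ) * (W 1 * W' 1) := by
  rw [rsZeta, show (fun x => rsKernel hn W W' s x) = fun _ => W 1 * W' 1 from
    funext (rsKernel_fin_zero W W' s), integral_const, Complex.real_smul]

omit [ValuativeRel F] [TopologicalSpace F] [IsNonarchimedeanLocalField F]
  [MeasurableSpace (GL (Fin 0) F ⧸ upperUnitriangular (Fin 0) F)] in
/-- A non-zero linear form takes a non-zero value. [folklore] -/
theorem exists_apply_ne_zero_of_ne_zero {W : Type*} [AddCommGroup W] [Module ℂ W]
    {Λ : Module.Dual ℂ W} (hΛ : Λ ≠ 0) : ∃ w, Λ w ≠ 0 := by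
  by_contra h
  push Not at h
  exact hΛ (LinearMap.ext h)

/-- **`L(s, π × 1_{GL_0}) = 1`.** For `m = 0`, a measure `ν` with `ν(pt)` finite and non-zero, a
`ψ`-generic `π` and a `ψ⁻¹`-generic `π'` of `GL_0`, the polynomial `P = 1` satisfies
`HasRSLFactor`: every `Ψ(s; W_v, W'_{v'}) = ν(pt) Λ(v) Λ'(v')` is a constant (clause (a) with the
constant Laurent polynomial), and choosing `Λ(v) Λ'(v') ≠ 0` a constant multiple of one zeta
integral is `1 = 1/P` (clause (b)). [folklore] -/
theorem hasRSLFactor_one_fin_zero (hν : ν.real Set.univ ≠ 0) (hg : IsGeneric π ψ)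
    (hg' : IsGeneric π' ψ⁻¹) : HasRSLFactor hn π π' ψ ν 1 := by
  have hL : ∀ a : ℂ, IsLaurent (RatFunc.C a) := fun a => ⟨Polynomial.C a, 0, by simp⟩
  refine ⟨by simp, fun Λ _ Λ' _ v v' => ⟨RatFunc.C ((ν.real Set.univ : ℂ) * (Λ v * Λ' v')), hL _,
    0, fun s _ => ?_⟩, ?_⟩
  · rw [rsZeta_fin_zero]
    simp only [whittakerModel_apply, map_one, Module.End.one_apply, rsLRat, inv_one, mul_one,
      evalAtQ, RatFunc.eval_C, RingHom.id_apply]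
  · obtain ⟨Λ, hΛ, hΛ0⟩ := (isGeneric_iff _ _).mp hg
    obtain ⟨Λ', hΛ', hΛ'0⟩ := (isGeneric_iff _ _).mp hg'
    obtain ⟨v, hv⟩ := exists_apply_ne_zero_of_ne_zero hΛ0
    obtain ⟨v', hv'⟩ := exists_apply_ne_zero_of_ne_zero hΛ'0
    have hc : ((ν.real Set.univ : ℂ)) ≠ 0 := Complex.ofReal_ne_zero.mpr hν
    refine ⟨1, fun _ => Λ, fun _ => Λ', fun _ => v, fun _ => v',
      fun _ => RatFunc.C ((ν.real Set.univ : ℂ) * (Λ v * Λ' v'))⁻¹, fun _ => hΛ, fun _ => hΛ',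
      fun _ => hL _, 0, fun s _ => ?_⟩
    dsimp only
    rw [Fin.sum_univ_one, rsZeta_fin_zero]
    simp only [whittakerModel_apply, map_one, Module.End.one_apply, rsLRat, inv_one,
      evalAtQ, RatFunc.eval_C, RatFunc.eval_one, RingHom.id_apply]
    field_simp

/-- **The intended fact holds for `m = 0`.** With the measure hypotheses that the `def` lost —
`ν` finite on compacts and positive on non-empty opens, on the one-point space `GL_0 ⧸ U_0`
simply `0 < ν(pt) < ∞` — `existsUnique_hasRSLFactor hn π π' ψ ν` holds for `GL_n × GL_0`
(`P = 1`, `hasRSLFactor_one_fin_zero`, and `HasRSLFactor.existsUnique_of_exists`). Contrast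
`not_forall_existsUnique_hasRSLFactor` (`ν = 0`). [folklore] -/
theorem existsUnique_hasRSLFactor_fin_zero [IsFiniteMeasureOnCompacts ν] [ν.IsOpenPosMeasure] :
    existsUnique_hasRSLFactor hn π π' ψ ν := by
  intro _ _ _ _ hg hg' _
  haveI : Subsingleton (GL (Fin 0) F ⧸ upperUnitriangular (Fin 0) F) := ⟨fun a b => by
    obtain ⟨a, rfl⟩ := QuotientGroup.mk_surjective a
    obtain ⟨b, rfl⟩ := QuotientGroup.mk_surjective b
    rw [Subsingleton.elim a b]⟩
  have hν : ν.real Set.univ ≠ 0 := by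
    rw [measureReal_def, ENNReal.toReal_ne_zero]
    exact ⟨isOpen_univ.measure_ne_zero ν Set.univ_nonempty, measure_ne_top ν _⟩
  exact HasRSLFactor.existsUnique_of_exists ⟨1, hasRSLFactor_one_fin_zero hν hg hg'⟩

end FinZero

end Literature.NumberTheory.Automorphic
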